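import Mathlib
import Summits.NavierStokesRegularity.NavierStokesRegularity.Theorems.EulerZoomLiouvillePowerGaugeEulerLiouvilleSelfSimilarLEI
import Summits.NavierStokesRegularity.NavierStokesRegularity.Theorems.EulerZoomLiouvillePowerGaugeEulerLiouvilleSelfSimilarGauges
import Summits.NavierStokesRegularity.NavierStokesRegularity.Theorems.EulerZoomLiouvillePowerGaugeEulerLiouvilleBackwardVanishing
import Summits.NavierStokesRegularity.NavierStokesRegularity.Theorems.EulerZoomLiouvillePowerGaugeEulerLiouvilleSelfSimilarOutgoingProfile
import HarnessLib

/-!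
# Rung C1 of the crux `EulerZoomLiouville.PowerGaugeEulerLiouville` inside the window: no self-similar
# Euler collapse without INWARD energy flux near the blow-up point (every `ρ > 0`)

Route №10 `EulerZoomLiouville` (NavierStokesRegularity), crux E = stmt-NavierStokesRegularity-19832,
tenure rung C1 (exactly self-similar members).  Seat ns-typeII-p2 g3 (cell ns-regularity-ideate §B).
Sequel of `…SelfSimilarOutgoingProfile.lean` (radial cutoff + profile-level Liouville under outward
Bernoulli flux).  Here the class enters: the forward profile local energy inequality of a self-similar
member (`selfSimilar_profile_energy_le_add_flux`, ns-typeII-p1), STUB 2 of the line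
(`Backward.vanishesBackward_of_gauge`, ns-typeII-p2: the local energy on `B(0,2)` is `≤ ε` outside a set of
times of vanishing density, hence at positive-measure sets of arbitrarily remote past times) and the
`A`-gauge bridge (`profile_energy_growth_of_gaugeA`: `|V|² ∈ L¹_loc`).

* `selfSimilar_profile_ae_eq_zero_near_origin_of_outgoingFlux` — every `ρ > 0`, LOCAL form: an exactly
  self-similar member of the class (the crux's three hypotheses at exponent `ρ`,
  `u(τ) = selfSimilarCollapse (1/(2+ρ)) 0 V τ`, `p(τ) = selfSimilarCollapsePressure (1/(2+ρ)) 0 P τ`) whose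
  profile has a.e. OUTWARD Bernoulli flux on `B_{r₀}`, `0 ≤ (|V(y)|² + 2P(y)) ⟪V(y), y⟫` for a.e.
  `|y| < r₀`, has `V = 0` a.e. on `B_{r₀/2}`.  Contrapositive portrait: a nontrivial self-similar collapse
  profile in Seregin's class carries INWARD Bernoulli flux on a positive-measure subset of EVERY
  neighbourhood of the blow-up point (for `C¹` profiles vanishing near the origin, Chae's continuation of
  the zero set, Adv. Math. 283 (2015), would then give `V ≡ 0`; not used here).
* `selfSimilar_ae_eq_zero_of_outgoingFlux` — GLOBAL form: outward flux a.e. on `ℝ³` ⇒ the member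
  vanishes a.e. on the slab `(−∞,0) × ℝ³` — an in-window STRATUM of rung C1 (`Sig.rungC1_selfSimilar`)
  valid for every `ρ > 0`, not only at the endpoint, in the member-hypothesis shape of
  `rungC1_of_profileLiouville_full`: «no self-similar Euler collapse without inward energy flux».

Only the local energy inequality and stub 2 are used: by critic-2's K3 notice (the NSI super-cascade
lies in «E minus the momentum identity») no LEI-only argument closes the core for small `ρ`; this
stratum records what the LEI lever gives on self-similar members at every `ρ` — the sign of the net
Bernoulli flux into the blow-up point.

WHAT THIS IS NOT: not NS, not E, not rung C1 — a kernel-checked in-window stratum `--supports` 19832.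
[folklore]
-/

noncomputable section

-- flat `Theorems/<Route><Decl>…` files of one crux share the namespace of the crux (tree convention)
set_option linter.dupNamespace false

open MeasureTheory Set Filter Topology Metric Function
open scoped ENNReal NNReal InnerProductSpace RealInnerProductSpace

namespace Summit.NavierStokesRegularity.NavierStokesRegularity.Theorems.PowerGaugeEulerLiouville

open Literature.Analysis Literature.Analysis.FunctionSpaces Literature.Analysis.FluidPDE

/-! ## Member level: the power-gauged class -/

section Member

variable {ρ : ℝ} {u : ℝ → EuclideanSpace ℝ (Fin 3) → EuclideanSpace ℝ (Fin 3)}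
  {p : ℝ → EuclideanSpace ℝ (Fin 3) → ℝ}
  {H : ℝ → EuclideanSpace ℝ (Fin 3) → EuclideanSpace ℝ (Fin 3) →L[ℝ] EuclideanSpace ℝ (Fin 3)}
  {c : ℝ≥0} {V : EuclideanSpace ℝ (Fin 3) → EuclideanSpace ℝ (Fin 3)}
  {P : EuclideanSpace ℝ (Fin 3) → ℝ}

/-- **No self-similar Euler collapse without inward energy flux near the blow-up point (every
`ρ > 0`).**  Let `(u, p, H)` satisfy the three hypotheses of the crux `PowerGaugeEulerLiouville` at
exponent `ρ > 0` (suitable weak ancient Euler pair on the slab, weak gradient, power gauge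
`a^{2ρ}A + a^{ρ}E + a^{2ρ}D ≤ c` for all `a > 0`) and be EXACTLY SELF-SIMILAR,
`u(τ) = selfSimilarCollapse (1/(2+ρ)) 0 V τ`, `p(τ) = selfSimilarCollapsePressure (1/(2+ρ)) 0 P τ`.  If
the profile's Bernoulli flux is OUTWARD a.e. on a ball, `0 ≤ (|V(y)|² + 2P(y)) ⟪V(y), y⟫` for a.e.
`|y| < r₀`, then `V = 0` a.e. on `B_{r₀/2}`.  Equivalently: a nontrivial self-similar collapse profile in
Seregin's class has INWARD Bernoulli flux on a positive-measure subset of every neighbourhood of the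
blow-up point.  Inputs: the forward profile LEI (`selfSimilar_profile_energy_le_add_flux`), stub 2 of
the line (`Backward.vanishesBackward_of_gauge`) for the far-past smallness, and the `A`-gauge bridge
(`profile_energy_growth_of_gaugeA`) for `|V|² ∈ L¹_loc`. [folklore] -/
theorem selfSimilar_profile_ae_eq_zero_near_origin_of_outgoingFlux (hρ : 0 < ρ)
    (hsw : IsSuitableWeakSolutionOn (slab (EuclideanSpace ℝ (Fin 3)) (Iio 0) isOpen_Iio) 0 0 u p)
    (hH : HasWeakSpatialGradientOn (slab (EuclideanSpace ℝ (Fin 3)) (Iio 0) isOpen_Iio) u H)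
    (hgauge : ∀ a : ℝ, 0 < a →
      ENNReal.ofReal (a ^ (2 * ρ)) * cknA a (0 : ℝ × EuclideanSpace ℝ (Fin 3)) u +
          ENNReal.ofReal (a ^ ρ) * cknE a (0 : ℝ × EuclideanSpace ℝ (Fin 3)) H +
        ENNReal.ofReal (a ^ (2 * ρ)) * cknD a (0 : ℝ × EuclideanSpace ℝ (Fin 3)) p ≤ (c : ℝ≥0∞))
    (hu : ∀ τ : ℝ, τ < 0 → u τ = selfSimilarCollapse (1 / (2 + ρ)) 0 V τ)
    (hp : ∀ τ : ℝ, τ < 0 → p τ = selfSimilarCollapsePressure (1 / (2 + ρ)) 0 P τ)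
    {r₀ : ℝ} (hr₀ : 0 < r₀)
    (hout : ∀ᵐ y ∂(volume : Measure (EuclideanSpace ℝ (Fin 3))), ‖y‖ < r₀ →
      0 ≤ (‖V y‖ ^ 2 + 2 * P y) * ⟪V y, y⟫) :
    ∀ᵐ y ∂(volume : Measure (EuclideanSpace ℝ (Fin 3))), ‖y‖ < r₀ / 2 → V y = 0 := by
  set γ : ℝ := 1 / (2 + ρ) with hγdef
  have hγ : 0 < γ := by rw [hγdef]; positivity
  -- the three gauges separately
  have hA : ∀ a : ℝ, 0 < a → ENNReal.ofReal (a ^ (2 * ρ)) *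
      cknA a (0 : ℝ × EuclideanSpace ℝ (Fin 3)) u ≤ (c : ℝ≥0∞) :=
    fun a ha => le_trans (le_trans le_self_add le_self_add) (hgauge a ha)
  have hE : ∀ a : ℝ, 0 < a → ENNReal.ofReal (a ^ ρ) *
      cknE a (0 : ℝ × EuclideanSpace ℝ (Fin 3)) H ≤ (c : ℝ≥0∞) :=
    fun a ha => le_trans (le_trans le_add_self le_self_add) (hgauge a ha)
  -- the cutoff
  obtain ⟨σ, hσ, hσcs, hσ0, hσle, hσ1, hσzero, k, hk, hσk⟩ := exists_radialCutoff
  -- measurability and local square-integrability of the profile (from the `A`-gauge)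
  have hum : AEStronglyMeasurable (uncurry u)
      (volume.restrict (Iio (0 : ℝ) ×ˢ (univ : Set (EuclideanSpace ℝ (Fin 3))))) := by
    have := hH.locallyIntegrableOn.aestronglyMeasurable
    simpa [slab] using this
  have hVm : AEStronglyMeasurable V volume := aestronglyMeasurable_profile hum hu
  have hgrowth := profile_energy_growth_of_gaugeA hρ hu hA
  have hV2 : LocallyIntegrable (fun y => ‖V y‖ ^ 2) volume := by
    refine fun y => ⟨ball (0 : EuclideanSpace ℝ (Fin 3)) (‖y‖ + 1),
      isOpen_ball.mem_nhds (by rw [mem_ball, dist_zero_right]; linarith), ?_⟩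
    have hL : 0 < ‖y‖ + 1 := by positivity
    refine ⟨(hVm.norm.pow 2).restrict, ?_⟩
    rw [hasFiniteIntegral_iff_enorm]
    have h1 : ∫⁻ z in ball (0 : EuclideanSpace ℝ (Fin 3)) (‖y‖ + 1), ‖‖V z‖ ^ 2‖ₑ =
        ∫⁻ z in ball (0 : EuclideanSpace ℝ (Fin 3)) (‖y‖ + 1), ‖V z‖ₑ ^ 2 := by
      refine lintegral_congr fun z => ?_
      rw [Real.enorm_eq_ofReal (sq_nonneg _), ← ofReal_norm, ENNReal.ofReal_pow (norm_nonneg _)]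
    rw [h1]
    exact lt_of_le_of_lt (hgrowth _ hL) (ENNReal.mul_lt_top ENNReal.coe_lt_top ENNReal.ofReal_lt_top)
  -- the forward profile local energy inequality
  have hLEI := selfSimilar_profile_energy_le_add_flux hsw hu hp hσ hσcs hσ0
  -- far-past smallness from stub 2 (backward vanishing on `B(0,2)`)
  have hsmall : ∀ ε : ℝ, 0 < ε → ∀ T : ℝ, ∃ᵐ τ ∂(volume : Measure ℝ),
      τ < -T ∧ (-τ) ^ (5 * γ - 2) * ∫ y, ‖V y‖ ^ 2 * σ ((-τ) ^ γ • y) ≤ ε := by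
    intro ε hε T
    have hvb := Backward.vanishesBackward_of_gauge hρ hH hA hE (R := 2) (ε := ε) two_pos hε
    set Bad : ℝ → Set ℝ := fun a => {τ : ℝ | τ ∈ Ioo (-(a ^ 2)) 0 ∧
      ENNReal.ofReal ε < ∫⁻ y in ball (0 : EuclideanSpace ℝ (Fin 3)) 2, ‖u τ y‖ₑ ^ 2} with hBad
    -- the physical local energy against `σ` is the profile quantity
    have hphys : ∀ τ : ℝ, τ < 0 →
        (-τ) ^ (5 * γ - 2) * ∫ y, ‖V y‖ ^ 2 * σ ((-τ) ^ γ • y) = ∫ x, ‖u τ x‖ ^ 2 * σ x := by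
      intro τ hτ
      rw [hu τ hτ, integral_norm_sq_selfSimilarCollapse_mul γ hτ]
    -- a time outside `Bad a` has local energy `≤ ε`
    have hgood : ∀ (a τ : ℝ), τ ∈ Ioo (-(a ^ 2)) 0 → τ ∉ Bad a →
        (-τ) ^ (5 * γ - 2) * ∫ y, ‖V y‖ ^ 2 * σ ((-τ) ^ γ • y) ≤ ε := by
      intro a τ hτ hnb
      have hle : ∫⁻ y in ball (0 : EuclideanSpace ℝ (Fin 3)) 2, ‖u τ y‖ₑ ^ 2 ≤ ENNReal.ofReal ε := by
        by_contra hcon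
        exact hnb ⟨hτ, not_le.1 hcon⟩
      rw [hphys τ hτ.2]
      -- `ofReal (∫ |u|² σ) ≤ ∫⁻_{B_2} |u|²`
      have hnn0 : 0 ≤ᵐ[volume] fun x => ‖u τ x‖ ^ 2 * σ x :=
        Eventually.of_forall fun x => mul_nonneg (sq_nonneg _) (hσ0 _)
      have h1 : ENNReal.ofReal (∫ x, ‖u τ x‖ ^ 2 * σ x) ≤
          ∫⁻ x, ENNReal.ofReal (‖u τ x‖ ^ 2 * σ x) := by
        by_cases hint : Integrable (fun x => ‖u τ x‖ ^ 2 * σ x) volume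
        · exact (ofReal_integral_eq_lintegral_ofReal hint hnn0).le
        · rw [integral_undef hint, ENNReal.ofReal_zero]
          exact bot_le
      have h2 : ∫⁻ x, ENNReal.ofReal (‖u τ x‖ ^ 2 * σ x) ≤
          ∫⁻ y in ball (0 : EuclideanSpace ℝ (Fin 3)) 2, ‖u τ y‖ₑ ^ 2 := by
        rw [← lintegral_indicator measurableSet_ball]
        refine lintegral_mono fun x => ?_
        by_cases hx : x ∈ ball (0 : EuclideanSpace ℝ (Fin 3)) 2
        · rw [indicator_of_mem hx, ← ofReal_norm, ← ENNReal.ofReal_pow (norm_nonneg _)]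
          exact ENNReal.ofReal_le_ofReal (mul_le_of_le_one_right (sq_nonneg _) (hσle _))
        · rw [indicator_of_notMem hx]
          rw [mem_ball, dist_zero_right, not_lt] at hx
          rw [hσzero x hx, mul_zero, ENNReal.ofReal_zero]
      have h3 := (h1.trans h2).trans hle
      exact (ENNReal.ofReal_le_ofReal_iff hε.le).1 h3
    -- choose `a` large: `a² > 2 (|T| + 1)` and `|Bad a| / a² < 1/2`
    have hev1 : ∀ᶠ a : ℝ in atTop, volume (Bad a) / ENNReal.ofReal (a ^ 2) < 1 / 2 :=
      (tendsto_order.1 hvb).2 _ (by norm_num)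
    have hev2 : ∀ᶠ a : ℝ in atTop, 2 * (|T| + 1) < a ^ 2 :=
      (tendsto_pow_atTop two_ne_zero).eventually_gt_atTop _
    obtain ⟨a, ha1, ha2⟩ := (hev1.and hev2).exists
    have ha2pos : 0 < a ^ 2 := by linarith [abs_nonneg T]
    -- the window `W = (−a², −a²/2)` lies below `−T` and has measure `a²/2 > |Bad a|`
    have hT : -(a ^ 2) / 2 ≤ -T := by
      have : T ≤ |T| := le_abs_self T
      linarith
    have hBadlt : volume (Bad a) < ENNReal.ofReal (a ^ 2 / 2) := by
      have h := ha1
      rw [ENNReal.div_lt_iff (Or.inl (ENNReal.ofReal_pos.2 ha2pos).ne') (Or.inl ENNReal.ofReal_ne_top)]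
        at h
      calc volume (Bad a) < 1 / 2 * ENNReal.ofReal (a ^ 2) := h
        _ = ENNReal.ofReal (a ^ 2 / 2) := by
          rw [show a ^ 2 / 2 = (1 / 2) * a ^ 2 by ring, ENNReal.ofReal_mul (by norm_num),
            ENNReal.ofReal_div_of_pos two_pos, ENNReal.ofReal_one, ENNReal.ofReal_ofNat]
    by_contra hcon
    -- `hcon`: a.e. `τ`, `¬ (τ < -T ∧ Φ τ ≤ ε)`; then `W ⊆ Bad a` a.e., contradiction with the measures
    have hae : ∀ᵐ τ ∂(volume : Measure ℝ), τ ∈ Ioo (-(a ^ 2)) (-(a ^ 2) / 2) → τ ∈ Bad a := by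
      have h := Filter.not_frequently.1 hcon
      filter_upwards [h] with τ hτ hW
      by_contra hnb
      have hτ0 : τ ∈ Ioo (-(a ^ 2)) 0 := ⟨hW.1, by linarith [hW.2]⟩
      exact hτ ⟨lt_of_lt_of_le hW.2 (by linarith), hgood a τ hτ0 hnb⟩
    have hWle : volume (Ioo (-(a ^ 2)) (-(a ^ 2) / 2)) ≤ volume (Bad a) := by
      refine measure_mono_ae ?_
      filter_upwards [hae] with τ hτ
      exact fun hW => hτ hW
    rw [Real.volume_Ioo, show -(a ^ 2) / 2 - -(a ^ 2) = a ^ 2 / 2 by ring] at hWle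
    exact absurd (hWle.trans_lt hBadlt) (lt_irrefl _)
  exact profile_ae_eq_zero_of_outgoingFlux hγ hσ0 hσle hσ1 hσzero hσ.continuous hk hσk hVm hV2
    hLEI hsmall hr₀ hout

/-- **No self-similar Euler collapse without inward energy flux (every `ρ > 0`) — global form.**  Under
the hypotheses of the crux `PowerGaugeEulerLiouville` at exponent `ρ > 0`, an EXACTLY SELF-SIMILAR
member whose profile has a.e. OUTWARD Bernoulli flux, `0 ≤ (|V(y)|² + 2P(y)) ⟪V(y), y⟫` for a.e. `y`,
vanishes a.e. on the slab `(−∞,0) × ℝ³`.  An in-window stratum of rung C1 (`Sig.rungC1_selfSimilar`)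
for every `ρ`, in the member-hypothesis shape of `rungC1_of_profileLiouville_full`. [folklore] -/
theorem selfSimilar_ae_eq_zero_of_outgoingFlux (hρ : 0 < ρ)
    (hsw : IsSuitableWeakSolutionOn (slab (EuclideanSpace ℝ (Fin 3)) (Iio 0) isOpen_Iio) 0 0 u p)
    (hH : HasWeakSpatialGradientOn (slab (EuclideanSpace ℝ (Fin 3)) (Iio 0) isOpen_Iio) u H)
    (hgauge : ∀ a : ℝ, 0 < a →
      ENNReal.ofReal (a ^ (2 * ρ)) * cknA a (0 : ℝ × EuclideanSpace ℝ (Fin 3)) u +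
          ENNReal.ofReal (a ^ ρ) * cknE a (0 : ℝ × EuclideanSpace ℝ (Fin 3)) H +
        ENNReal.ofReal (a ^ (2 * ρ)) * cknD a (0 : ℝ × EuclideanSpace ℝ (Fin 3)) p ≤ (c : ℝ≥0∞))
    (hu : ∀ τ : ℝ, τ < 0 → u τ = selfSimilarCollapse (1 / (2 + ρ)) 0 V τ)
    (hp : ∀ τ : ℝ, τ < 0 → p τ = selfSimilarCollapsePressure (1 / (2 + ρ)) 0 P τ)
    (hout : ∀ᵐ y ∂(volume : Measure (EuclideanSpace ℝ (Fin 3))),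
      0 ≤ (‖V y‖ ^ 2 + 2 * P y) * ⟪V y, y⟫) :
    uncurry u =ᵐ[volume.restrict (Iio (0 : ℝ) ×ˢ (univ : Set (EuclideanSpace ℝ (Fin 3))))] 0 := by
  have hum : AEStronglyMeasurable (uncurry u)
      (volume.restrict (Iio (0 : ℝ) ×ˢ (univ : Set (EuclideanSpace ℝ (Fin 3))))) := by
    have := hH.locallyIntegrableOn.aestronglyMeasurable
    simpa [slab] using this
  -- `V = 0` a.e. on every ball `B_{n+1}` (local theorem with `r₀ = 2(n+1)`)
  have hn : ∀ n : ℕ, ∀ᵐ y ∂(volume : Measure (EuclideanSpace ℝ (Fin 3))),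
      ‖y‖ < (n : ℝ) + 1 → V y = 0 := by
    intro n
    have h := selfSimilar_profile_ae_eq_zero_near_origin_of_outgoingFlux hρ hsw hH hgauge hu hp
      (r₀ := 2 * ((n : ℝ) + 1)) (by positivity) (hout.mono fun y hy _ => hy)
    filter_upwards [h] with y hy hyn
    exact hy (by linarith)
  rw [← ae_all_iff] at hn
  have hV0 : V =ᵐ[volume] 0 := by
    filter_upwards [hn] with y hy
    obtain ⟨n, hn'⟩ := exists_nat_gt ‖y‖
    exact hy n (by linarith)
  exact selfSimilar_ae_eq_zero_of_profile hum hu hV0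

end Member

end Summit.NavierStokesRegularity.NavierStokesRegularity.Theorems.PowerGaugeEulerLiouville

end
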